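import Literature.Computability.QuantumComplexity.PathModelEncodedQubits
import HarnessLib

/-!
# Windows of the encoded path model: braid generators act locally on blocks of strands

Topic `Literature/Computability/QuantumComplexity`; sibling of `PathModelEncodedQubits.lean`
(the 4-steps code `encodeBits : QReg N → QReg (N * 4)` of Aharonov–Arad 2011, §3.1, and the exact
one-qubit action of the in-block generators). A two-qubit gate of the `PromiseBQP`-hardness
reduction is a braid on the EIGHT strands of two adjacent blocks (Aharonov–Arad §3.2: "the
generators of `B_8` act on the `8` strands of the two encoded qubits"), and in between the state
of those strands leaves the code; what makes the construction work is that the path-model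
representation of such a braid on `4N` strands is determined by the `8`-strand (in general
`4m`-strand) path model: **locality**. Precisely (everything at `k = 5`):

* `splice x a u` — the string `encodeBits x` with the window of `m` blocks starting at block `a`
  overwritten by `u : QReg (m * 4)`; `splice_encodeBits_window : splice x a (encodeBits (window x
  a)) = encodeBits x`;
* positions and validity inside/after the window (`pathPos_splice_*`, `isGkPath_splice_iff`): if
  the window walk `u` returns to vertex `1` (as every walk reachable from a code word by flips
  does), `splice x a u ∈ P_{4N,5} ↔ u ∈ P_{4m,5}`;
* `spliceIso x a`, the partial isometry `|u⟩ ↦ |splice x a u⟩` on window walks returning to `1`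
  (zero on the others);
* **`ajlPhiC_windowGen_mul_spliceIso`**, **`ajlCrossingMatrix_windowGen_mul_spliceIso`**,
  **`windowWord_mul_spliceIso`**: for a generator `σ_{4a+r}` with both strands in the window,
  `Φ^{(4N)}_{4a+r} · spliceIso = spliceIso · Φ^{(4m)}_r`, likewise for crossings of either sign and
  for whole words — the operator of a window braid on the big register, applied to a spliced
  state, is the splice of the small operator applied to the window (AJL eq. (3.1): an entry of
  `Φ_i` depends only on bits `i, i+1` and the vertex before bit `i`, and a code prefix ends at
  vertex `1`).

With `m = 2` this reduces every statement about the encoded two-qubit gadgets on `4N` strands to a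
computation in the `13`-dimensional space of walks `1 → 1` of length `8`.

## References

* D. Aharonov, I. Arad, New J. Phys. 13 (2011) 035019; arXiv:quant-ph/0605181, §3.1–§3.2
  [AharonovArad2011].
* D. Aharonov, V. Jones, Z. Landau, Algorithmica 55 (2009); arXiv:quant-ph/0511096, §3.1
  eq. (3.1) [AharonovJonesLandau2009].
-/

noncomputable section

open Matrix Finset

namespace Literature.Computability.QuantumComplexity

open Cryptography

variable {N m : ℕ}

/-! ### Splicing a window into a code string -/

/-- **Splice**: the code string of `x` with bits `4a, …, 4a + 4m - 1` (blocks `a, …, a+m-1`)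
replaced by the window string `u`. [cite: AharonovArad2011, §3.2] -/
def splice (x : QReg N) (a : ℕ) (u : QReg (m * 4)) : QReg (N * 4) := fun t =>
  if h : 4 * a ≤ (t : ℕ) ∧ (t : ℕ) < 4 * a + m * 4 then u ⟨(t : ℕ) - 4 * a, by omega⟩ else encodeBits x t

/-- The part of `x` in the window: qubits `a, …, a + m - 1`. [cite: AharonovArad2011, §3.2] -/
def window (x : QReg N) (a : ℕ) (ham : a + m ≤ N) : QReg m := fun j => x ⟨a + j, by omega⟩

/-- The braid generator `σ_{4a+r+1}` of the big register (0-indexed `4a + r`).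
[cite: AharonovArad2011, §3.2] -/
def windowGen (a r : ℕ) (h : 4 * a + r + 1 < N * 4) : Fin (N * 4 - 1) := ⟨4 * a + r, by omega⟩

/-- **The splice map as a matrix** `QReg (4N) × QReg (4m)`: column `u` is `|splice x a u⟩` if the
window walk `u` returns to vertex `1` after its `4m` steps, and `0` otherwise.
[cite: AharonovArad2011, §3.2] -/
def spliceIso (x : QReg N) (a m : ℕ) : Matrix (QReg (N * 4)) (QReg (m * 4)) ℂ :=
  Matrix.of fun p u => if pathPos u (m * 4) = 1 ∧ p = splice x a u then 1 else 0

/-! ### Values and positions of a spliced string -/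

/-- Before the window a spliced string is the code string. [folklore] -/
theorem splice_apply_of_lt (x : QReg N) (a : ℕ) (u : QReg (m * 4)) (t : Fin (N * 4)) (ht : (t : ℕ) < 4 * a) :
    splice x a u t = encodeBits x t := by
  unfold splice; rw [dif_neg]; omega

/-- Inside the window a spliced string is the window string. [folklore] -/
theorem splice_apply_window (x : QReg N) (a : ℕ) (u : QReg (m * 4)) (t : Fin (N * 4))
    (h1 : 4 * a ≤ (t : ℕ)) (h2 : (t : ℕ) < 4 * a + m * 4) :
    splice x a u t = u ⟨(t : ℕ) - 4 * a, by omega⟩ := by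
  unfold splice; rw [dif_pos ⟨h1, h2⟩]

/-- After the window a spliced string is the code string. [folklore] -/
theorem splice_apply_of_ge (x : QReg N) (a : ℕ) (u : QReg (m * 4)) (t : Fin (N * 4))
    (ht : 4 * a + m * 4 ≤ (t : ℕ)) : splice x a u t = encodeBits x t := by
  unfold splice; rw [dif_neg]; omega

/-- Splicing is injective in the window string (when the window fits). [folklore] -/
theorem splice_injective (x : QReg N) {a : ℕ} (ham : a + m ≤ N) :
    Function.Injective (splice (m := m) x a) := by
  intro u v h
  funext j
  have hj : 4 * a + (j : ℕ) < N * 4 := by have := j.isLt; omega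
  have := congr_fun h ⟨4 * a + j, hj⟩
  rw [splice_apply_window x a u _ (by show 4 * a ≤ 4 * a + (j : ℕ); omega)
      (by show 4 * a + (j : ℕ) < 4 * a + m * 4; have := j.isLt; omega),
    splice_apply_window x a v _ (by show 4 * a ≤ 4 * a + (j : ℕ); omega)
      (by show 4 * a + (j : ℕ) < 4 * a + m * 4; have := j.isLt; omega)] at this
  have e : (⟨(4 * a + (j : ℕ)) - 4 * a, by omega⟩ : Fin (m * 4)) = j := Fin.ext (by simp)
  rwa [e] at this

/-- **The code string is the splice of its own window**: `splice x a (enc (window x a)) = enc x`.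
[cite: AharonovArad2011, §3.2] -/
theorem splice_encodeBits_window (x : QReg N) {a : ℕ} (ham : a + m ≤ N) :
    splice x a (encodeBits (window x a ham)) = encodeBits x := by
  funext t
  by_cases h : 4 * a ≤ (t : ℕ) ∧ (t : ℕ) < 4 * a + m * 4
  · rw [splice_apply_window x a _ t h.1 h.2]
    obtain ⟨b, r, hr, ht⟩ : ∃ b r : ℕ, r < 4 ∧ (t : ℕ) = 4 * b + r :=
      ⟨t / 4, t % 4, Nat.mod_lt _ (by norm_num), by omega⟩
    have hb : b < N := by have := t.isLt; omega
    have hab : a ≤ b := by omega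
    have hbm : b - a < m := by omega
    rw [encodeBits_apply x ⟨b, hb⟩ hr t ht,
      encodeBits_apply (window x a ham) ⟨b - a, hbm⟩ hr _ (by simp; omega)]
    unfold window
    congr 2
    exact Fin.ext (by simp; omega)
  · unfold splice; rw [dif_neg h]

/-- **Positions inside the window**: after `4a + j` steps a spliced string is where the window walk
is after `j` steps (the code prefix ends at vertex `1`). [cite: AharonovArad2011, §3.2] -/
theorem pathPos_splice_window (x : QReg N) {a : ℕ} (ham : a + m ≤ N) (u : QReg (m * 4)) {j : ℕ}
    (hj : j ≤ m * 4) : pathPos (splice x a u) (4 * a + j) = pathPos u j := by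
  induction j with
  | zero =>
    rw [add_zero, pathPos_zero, ← pathPos_encodeBits_mul x (show a ≤ N by omega)]
    exact pathPos_eq_of_agree fun t ht => splice_apply_of_lt x a u t ht
  | succ j ih =>
    have h1 : 4 * a + j < N * 4 := by omega
    have h2 : j < m * 4 := by omega
    rw [show 4 * a + (j + 1) = 4 * a + j + 1 by ring, pathPos_succ _ h1, pathPos_succ _ h2, ih (by omega),
      splice_apply_window x a u _ (by show 4 * a ≤ 4 * a + j; omega) (by show 4 * a + j < 4 * a + m * 4; omega)]
    congr 3
    exact Fin.ext (by simp)

/-- Positions before the window are those of the code string. [folklore] -/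
theorem pathPos_splice_of_le (x : QReg N) (a : ℕ) (u : QReg (m * 4)) {j : ℕ} (hj : j ≤ 4 * a) :
    pathPos (splice x a u) j = pathPos (encodeBits x) j :=
  pathPos_eq_of_agree fun t ht => splice_apply_of_lt x a u t (by omega)

/-- **Positions after the window** are those of the code string, provided the window walk returns
to vertex `1`. [cite: AharonovArad2011, §3.2] -/
theorem pathPos_splice_of_ge (x : QReg N) {a : ℕ} (ham : a + m ≤ N) {u : QReg (m * 4)}
    (hu : pathPos u (m * 4) = 1) {t : ℕ} (ht : 4 * a + m * 4 ≤ t) (htN : t ≤ N * 4) :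
    pathPos (splice x a u) t = pathPos (encodeBits x) t := by
  obtain ⟨d, rfl⟩ : ∃ d, t = 4 * a + m * 4 + d := ⟨t - (4 * a + m * 4), by omega⟩
  induction d with
  | zero =>
    rw [add_zero, pathPos_splice_window x ham u le_rfl, hu,
      show 4 * a + m * 4 = 4 * (a + m) by ring, pathPos_encodeBits_mul x ham]
  | succ d ih =>
    have h1 : 4 * a + m * 4 + d < N * 4 := by omega
    rw [show 4 * a + m * 4 + (d + 1) = 4 * a + m * 4 + d + 1 by ring, pathPos_succ _ h1, pathPos_succ _ h1,
      ih (by omega) (by omega), splice_apply_of_ge x a u _ (by show 4 * a + m * 4 ≤ 4 * a + m * 4 + d; omega)]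

/-- **Validity of a spliced string**: if the window walk returns to `1`, the spliced string is a
walk of `P_{4N,5}` iff the window is a walk of `P_{4m,5}`. [cite: AharonovArad2011, §3.2] -/
theorem isGkPath_splice_iff (x : QReg N) {a : ℕ} (ham : a + m ≤ N) {u : QReg (m * 4)}
    (hu : pathPos u (m * 4) = 1) : IsGkPath 5 (N * 4) (splice x a u) ↔ IsGkPath 5 (m * 4) u := by
  constructor
  · intro h j hj
    rw [← pathPos_splice_window x ham u hj]
    exact h _ (by omega)
  · intro h t ht
    rcases Nat.lt_or_ge t (4 * a) with h1 | h1
    · rw [pathPos_splice_of_le x a u h1.le]; exact isGkPath_encodeBits x t ht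
    rcases Nat.lt_or_ge t (4 * a + m * 4) with h2 | h2
    · obtain ⟨j, rfl⟩ : ∃ j, t = 4 * a + j := ⟨t - 4 * a, by omega⟩
      rw [pathPos_splice_window x ham u (by omega)]; exact h j (by omega)
    · rw [pathPos_splice_of_ge x ham hu h2 ht]; exact isGkPath_encodeBits x t ht

/-! ### Window generators: bits, flips -/

section Gen

variable (x : QReg N) {a r : ℕ} (ham : a + m ≤ N) (hr : r + 2 ≤ m * 4)

/-- The big generator index is in range when the window fits. [folklore] -/
theorem windowGen_lt (ham : a + m ≤ N) (hr : r + 2 ≤ m * 4) : 4 * a + r + 1 < N * 4 := by omega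

/-- The small generator index is in range. [folklore] -/
theorem windowGen_small_lt (hr : r + 2 ≤ m * 4) : r < m * 4 - 1 := by omega

include ham hr

/-- First bit of the window generator on a spliced string. [folklore] -/
theorem splice_genFst_windowGen (u : QReg (m * 4)) :
    splice x a u (genFst (windowGen a r (windowGen_lt ham hr))) = u (genFst ⟨r, windowGen_small_lt hr⟩) := by
  rw [splice_apply_window x a u _ (by show 4 * a ≤ 4 * a + r; omega)
    (by show 4 * a + r < 4 * a + m * 4; omega)]
  congr 1; exact Fin.ext (by simp [windowGen])

/-- Second bit of the window generator on a spliced string. [folklore] -/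
theorem splice_genSnd_windowGen (u : QReg (m * 4)) :
    splice x a u (genSnd (windowGen a r (windowGen_lt ham hr))) = u (genSnd ⟨r, windowGen_small_lt hr⟩) := by
  rw [splice_apply_window x a u _ (by show 4 * a ≤ 4 * a + r + 1; omega)
    (by show 4 * a + r + 1 < 4 * a + m * 4; omega)]
  congr 1; exact Fin.ext (by simp [windowGen]; omega)

/-- **Flipping at a window generator flips the window.** [cite: AharonovArad2011, §3.2] -/
theorem flipTo_splice_windowGen (u : QReg (m * 4)) (b : Bool) :
    flipTo (splice x a u) (windowGen a r (windowGen_lt ham hr)) b =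
      splice x a (flipTo u ⟨r, windowGen_small_lt hr⟩ b) := by
  funext t
  by_cases h1 : t = genFst (windowGen a r (windowGen_lt ham hr))
  · subst h1
    rw [flipTo_genFst, splice_genFst_windowGen x ham hr, flipTo_genFst]
  by_cases h2 : t = genSnd (windowGen a r (windowGen_lt ham hr))
  · subst h2
    rw [flipTo_genSnd, splice_genSnd_windowGen x ham hr, flipTo_genSnd]
  rw [flipTo_of_ne _ _ _ h1 h2]
  have hv1 : (t : ℕ) ≠ 4 * a + r := fun e => h1 (Fin.ext (by simp [windowGen, e]))
  have hv2 : (t : ℕ) ≠ 4 * a + r + 1 := fun e => h2 (Fin.ext (by simp [windowGen, e]))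
  by_cases hw : 4 * a ≤ (t : ℕ) ∧ (t : ℕ) < 4 * a + m * 4
  · rw [splice_apply_window x a u t hw.1 hw.2, splice_apply_window x a _ t hw.1 hw.2, flipTo_of_ne]
    · exact fun e => hv1 (by have := congrArg Fin.val e; simp at this; omega)
    · exact fun e => hv2 (by have := congrArg Fin.val e; simp at this; omega)
  · unfold splice; rw [dif_neg hw, dif_neg hw]

/-- The vertex before the window generator on a spliced string is the vertex of the window walk.
[cite: AharonovArad2011, §3.2] -/
theorem pathPos_splice_windowGen (u : QReg (m * 4)) :
    pathPos (splice x a u) (windowGen a r (windowGen_lt ham hr)) = pathPos u r := by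
  show pathPos (splice x a u) (4 * a + r) = pathPos u r
  exact pathPos_splice_window x ham u (by omega)

end Gen

/-! ### The splice map and the locality of the generators -/

/-- Entries of `spliceIso` (definitional). [folklore] -/
theorem spliceIso_apply (x : QReg N) (a m : ℕ) (p : QReg (N * 4)) (u : QReg (m * 4)) :
    spliceIso x a m p u = if pathPos u (m * 4) = 1 ∧ p = splice x a u then 1 else 0 := rfl

/-- **`spliceIso` on basis states**: `|u⟩ ↦ |splice x a u⟩` for window walks returning to `1`, else
`0`. [cite: AharonovArad2011, §3.2] -/
theorem spliceIso_mulVec_basisState (x : QReg N) {a : ℕ} (ham : a + m ≤ N) (u : QReg (m * 4)) :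
    spliceIso x a m *ᵥ basisState u = if pathPos u (m * 4) = 1 then basisState (splice x a u) else 0 := by
  have _ := ham
  funext p
  simp only [Matrix.mulVec, dotProduct, basisState_apply, mul_ite, mul_one, mul_zero, Finset.sum_ite_eq',
    Finset.mem_univ, if_true, spliceIso_apply]
  by_cases hu : pathPos u (m * 4) = 1
  · rw [if_pos hu, basisState_apply]
    by_cases hp : p = splice x a u
    · rw [if_pos ⟨hu, hp⟩, if_pos hp]
    · rw [if_neg (fun h => hp h.2), if_neg hp]
  · rw [if_neg (fun h => hu h.1), if_neg hu]; rfl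

/-- The complex image of the zero real vector is zero. [folklore] -/
theorem ofReal_comp_zero (n : ℕ) : (fun q : QReg n => (((0 : QReg n → ℝ) q : ℝ) : ℂ)) = 0 := by
  funext q; simp

/-- The real column formula `D • e_p + C • e_q`, pushed along `spliceIso` (linearity). [folklore] -/
theorem spliceIso_mulVec_ofReal_comp (x : QReg N) {a : ℕ} (ham : a + m ≤ N) (D C : ℝ)
    (u v : QReg (m * 4)) (hu : pathPos u (m * 4) = 1) (hv : pathPos v (m * 4) = 1) :
    spliceIso x a m *ᵥ (fun w => (((D • Pi.single u (1 : ℝ) + C • Pi.single v (1 : ℝ) : QReg (m * 4) → ℝ) w : ℝ) : ℂ)) =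
      (D : ℂ) • basisState (splice x a u) + (C : ℂ) • basisState (splice x a v) := by
  rw [ofReal_comp_smul_single_add, mulVec_add, mulVec_smul, mulVec_smul,
    spliceIso_mulVec_basisState x ham, spliceIso_mulVec_basisState x ham, if_pos hu, if_pos hv]

/-- **Locality of the path-model generators** (matrix form): for a generator with both strands in
the window, `Φ^{(4N)}_{4a+r} · spliceIso x a = spliceIso x a · Φ^{(4m)}_r` — the entry of `Φ_i` at
`(q, p)` depends only on bits `i, i+1` of `p, q` and the vertex of `p` before bit `i`
(AJL eq. (3.1)), and the code prefix returns to vertex `1`. [cite: AharonovArad2011, §3.2] -/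
theorem ajlPhiC_windowGen_mul_spliceIso (x : QReg N) {a r : ℕ} (ham : a + m ≤ N) (hr : r + 2 ≤ m * 4) :
    ajlPhiC 5 (N * 4) (windowGen a r (windowGen_lt ham hr)) * spliceIso x a m =
      spliceIso x a m * ajlPhiC 5 (m * 4) ⟨r, windowGen_small_lt hr⟩ := by
  set g := windowGen a r (windowGen_lt ham hr) with hg
  set i : Fin (m * 4 - 1) := ⟨r, windowGen_small_lt hr⟩ with hi
  refine Matrix.ext fun p u => ?_
  -- both sides, column `u`
  have lhs : (ajlPhiC 5 (N * 4) g * spliceIso x a m).col u =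
      ajlPhiC 5 (N * 4) g *ᵥ (spliceIso x a m *ᵥ basisState u) := by
    rw [basisState, Matrix.mulVec_single_one]; ext q; simp [Matrix.mul_apply, Matrix.mulVec, dotProduct]
  have rhs : (spliceIso x a m * ajlPhiC 5 (m * 4) i).col u =
      spliceIso x a m *ᵥ (ajlPhiC 5 (m * 4) i *ᵥ basisState u) := by
    rw [basisState, Matrix.mulVec_single_one]; ext q; simp [Matrix.mul_apply, Matrix.mulVec, dotProduct]
  suffices h : (ajlPhiC 5 (N * 4) g * spliceIso x a m).col u = (spliceIso x a m * ajlPhiC 5 (m * 4) i).col u from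
    congr_fun h p
  rw [lhs, rhs, spliceIso_mulVec_basisState x ham]
  by_cases hu : pathPos u (m * 4) = 1
  swap
  · -- window walks not returning to `1`: the column of `spliceIso` vanishes, and so does the
    -- push-forward of `Φ_r e_u` (its support consists of flips of `u`, with the same endpoint)
    rw [if_neg hu, mulVec_zero, basisState, Matrix.mulVec_single_one, col_ajlPhiC]
    by_cases hval : IsGkPath 5 (m * 4) u ∧ u (genSnd i) = !u (genFst i)
    · rw [col_ajlPhi hval.1 hval.2, ofReal_comp_smul_single_add, mulVec_add, mulVec_smul, mulVec_smul,
        spliceIso_mulVec_basisState x ham, spliceIso_mulVec_basisState x ham, if_neg hu, if_neg]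
      · simp
      · rw [pathPos_flipTo_of_ge u i _ hval.2 (by simp [hi]; omega)]; exact hu
    · have hz : ¬ IsGkPath 5 (m * 4) u ∨ u (genSnd i) = u (genFst i) := by
        by_cases h1 : IsGkPath 5 (m * 4) u
        · right; cases h : u (genFst i) <;> cases h' : u (genSnd i) <;> simp_all
        · left; exact h1
      rw [col_ajlPhi_eq_zero hz, ofReal_comp_zero, mulVec_zero]
  rw [if_pos hu, basisState, basisState, Matrix.mulVec_single_one, Matrix.mulVec_single_one, col_ajlPhiC,
    col_ajlPhiC]
  have hbits1 := splice_genFst_windowGen x ham hr u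
  have hbits2 := splice_genSnd_windowGen x ham hr u
  rw [← hg] at hbits1 hbits2
  by_cases hval : IsGkPath 5 (m * 4) u ∧ u (genSnd i) = !u (genFst i)
  · -- the generic case: both column formulas apply, with the same vertex and the same bits
    have hval' : IsGkPath 5 (N * 4) (splice x a u) := (isGkPath_splice_iff x ham hu).2 hval.1
    have hc' : splice x a u (genSnd g) = !splice x a u (genFst g) := by rw [hbits1, hbits2]; exact hval.2
    have hv : pathPos (flipTo u i (!u (genFst i))) (m * 4) = 1 := by
      rw [pathPos_flipTo_of_ge u i _ hval.2 (by simp [hi]; omega)]; exact hu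
    rw [col_ajlPhi hval.1 hval.2, col_ajlPhi hval' hc', spliceIso_mulVec_ofReal_comp x ham _ _ _ _ hu hv,
      ofReal_comp_smul_single_add, pathPos_splice_windowGen x ham hr, hbits1, hg,
      flipTo_splice_windowGen x ham hr]
  · -- the degenerate cases: both columns vanish
    have hz : ¬ IsGkPath 5 (m * 4) u ∨ u (genSnd i) = u (genFst i) := by
      by_cases h1 : IsGkPath 5 (m * 4) u
      · right; cases h : u (genFst i) <;> cases h' : u (genSnd i) <;> simp_all
      · left; exact h1
    have hz' : ¬ IsGkPath 5 (N * 4) (splice x a u) ∨ splice x a u (genSnd g) = splice x a u (genFst g) := by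
      rcases hz with h | h
      · left; rwa [isGkPath_splice_iff x ham hu]
      · right; rw [hbits1, hbits2]; exact h
    rw [col_ajlPhi_eq_zero hz, col_ajlPhi_eq_zero hz', ofReal_comp_zero, ofReal_comp_zero, mulVec_zero]

/-- **Locality of the crossings**: `ρ^{(4N)}(σ_{4a+r}^ε) · spliceIso = spliceIso · ρ^{(4m)}(σ_r^ε)`.
[cite: AharonovArad2011, §3.2] -/
theorem ajlCrossingMatrix_windowGen_mul_spliceIso (x : QReg N) {a r : ℕ} (ham : a + m ≤ N)
    (hr : r + 2 ≤ m * 4) (ε : Bool) :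
    ajlCrossingMatrix 5 (windowGen a r (windowGen_lt ham hr), ε) * spliceIso x a m =
      spliceIso x a m * ajlCrossingMatrix 5 ((⟨r, windowGen_small_lt hr⟩ : Fin (m * 4 - 1)), ε) := by
  change (crossingWeight (ajlPoint 5) ε true • ajlPhiC 5 (N * 4) (windowGen a r (windowGen_lt ham hr)) +
      crossingWeight (ajlPoint 5) ε false • (1 : Matrix _ _ ℂ)) * spliceIso x a m =
    spliceIso x a m * (crossingWeight (ajlPoint 5) ε true • ajlPhiC 5 (m * 4) ⟨r, windowGen_small_lt hr⟩ +
      crossingWeight (ajlPoint 5) ε false • (1 : Matrix _ _ ℂ))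
  rw [Matrix.add_mul, Matrix.smul_mul, Matrix.smul_mul, Matrix.one_mul, Matrix.mul_add, Matrix.mul_smul,
    Matrix.mul_smul, Matrix.mul_one, ajlPhiC_windowGen_mul_spliceIso x ham hr]

/-- **Locality of window braids**: for a word of window letters `(r_t, ε_t)` (all `r_t + 2 ≤ 4m`),
the product of the big crossing matrices intertwines `spliceIso` with the product of the small
ones. [cite: AharonovArad2011, §3.2] -/
theorem windowWord_mul_spliceIso (x : QReg N) {a : ℕ} (ham : a + m ≤ N)
    (w : List ({r : ℕ // r + 2 ≤ m * 4} × Bool)) :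
    (w.map fun l => ajlCrossingMatrix 5 (windowGen a l.1.1 (windowGen_lt ham l.1.2), l.2)).prod *
        spliceIso x a m =
      spliceIso x a m *
        (w.map fun l => ajlCrossingMatrix 5 ((⟨l.1.1, windowGen_small_lt l.1.2⟩ : Fin (m * 4 - 1)), l.2)).prod := by
  induction w with
  | nil => simp
  | cons l w ih =>
    rw [List.map_cons, List.map_cons, List.prod_cons, List.prod_cons, Matrix.mul_assoc, ih,
      ← Matrix.mul_assoc, ajlCrossingMatrix_windowGen_mul_spliceIso x ham l.1.2, Matrix.mul_assoc]

/-- **Window braids on code states**: the big operator applied to `|enc x⟩` is the splice of the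
small operator applied to the window code word `|enc (window x a)⟩`.
[cite: AharonovArad2011, §3.2] -/
theorem windowWord_mulVec_basisState_encodeBits (x : QReg N) {a : ℕ} (ham : a + m ≤ N)
    (w : List ({r : ℕ // r + 2 ≤ m * 4} × Bool)) :
    (w.map fun l => ajlCrossingMatrix 5 (windowGen a l.1.1 (windowGen_lt ham l.1.2), l.2)).prod *ᵥ
        basisState (encodeBits x) =
      spliceIso x a m *ᵥ
        ((w.map fun l => ajlCrossingMatrix 5 ((⟨l.1.1, windowGen_small_lt l.1.2⟩ : Fin (m * 4 - 1)), l.2)).prod *ᵥ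
          basisState (encodeBits (window x a ham))) := by
  have h0 : basisState (encodeBits x) = spliceIso x a m *ᵥ basisState (encodeBits (window x a ham)) := by
    have hw : pathPos (encodeBits (window x a ham)) (m * 4) = 1 := by
      have key : ∀ j, j = 4 * m → pathPos (encodeBits (window x a ham)) j = 1 :=
        fun j hj => hj ▸ pathPos_encodeBits_mul _ le_rfl
      exact key (m * 4) (Nat.mul_comm _ _)
    rw [spliceIso_mulVec_basisState x ham, if_pos hw, splice_encodeBits_window x ham]
  rw [h0, mulVec_mulVec, mulVec_mulVec, windowWord_mul_spliceIso x ham]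

end Literature.Computability.QuantumComplexity

end
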